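import Literature.NumberTheory.Automorphic.UnitaryGroupLocalFactors
import Literature.Topology.Algebra.RestrictedProduct.Cutout
import HarnessLib

/-!
# `U(J)(𝔸_{F,f}) = ∏'_v (U(J)(F_v) : U(J)(𝒪_v))` — the finite-adelic unitary group as a restricted product
(Platonov–Rapinchuk, *Algebraic Groups and Number Theory* (1994), §5.1;
Cassels–Fröhlich, *Algebraic Number Theory* (1967), Ch. II §§13–14;
Borel–Jacquet, *Automorphic forms and automorphic representations*, PSPM 33.1 (1979), §4.1)

Topic `NumberTheory/Automorphic`; namespace `Literature.NumberTheory.Automorphic` (grouping sub-namespaces `GLn`,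
`UnitaryGroup`). Definitions and proved theorems only: **no named facts, no `sorry`**.

**Setting** — that of `UnitaryGroupAutomorphicRep` / `UnitaryGroupLocalFactors`: `E/F` number fields,
`c : E ≃ₐ[F] E`, `N : ℕ`, `J ∈ M_N(E)` (any).

* `UnitaryGroup.conjFiniteAdele F E c : 𝔸_E^∞ →+* 𝔸_E^∞` — `c ⊗ 1` on the finite adeles of `E` (the accepted
  action `instMulSemiringActionFiniteAdeleRing` of `GaloisActionAdeleRing`, packaged as a ring hom; the finite
  part of `UnitaryGroup.conjAdele`);
* **`UnitaryGroup.finAdelic F E c N J ≤ GL_N(𝔸_E^∞)`** — the finite-adelic points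
  `U(J)(𝔸_{F,f}) = {g ∈ GL_N(𝔸_E^∞) | ((c ⊗ 1) g)ᵀ · J · g = J}`; closed (`isClosed_finAdelic`); its PLACEWISE
  membership criterion `mem_finAdelic_iff_forall` (`∀ w, (c_* g_{c⁻¹ w})ᵀ J g_w = J` in `M_N(E_w)`);
* `UnitaryGroup.ofFinite_mem_adelic_iff` : `(1, g) ∈ U(J)(𝔸_F) ↔ g ∈ U(J)(𝔸_{F,f})`, whence
  `finAdelicToAdelic : finAdelic →* (adelicGroupData F E c N J).Adelic` with range the tree's
  `UnitaryGroup.finiteAdelic` (`range_finAdelicToAdelic`) — the two descriptions of the finite-adelic points agree;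
* `GLn.restrictedPiContinuousMulEquiv N E : GL_N(𝔸_E^∞) ≃ₜ* ∏'_w [GL_N(E_w), GL_N(𝒪_w)]` (the tree's `GLn.restrictedPiEquiv` and
  `GLn.restrictedPiHomeomorph` as ONE `ContinuousMulEquiv`);
* the MAIN THEOREM **`UnitaryGroup.finAdelicEquiv F E c N J :
  finAdelic F E c N J ≃ₜ* Πʳ (v : HeightOneSpectrum (𝓞 F)), [localPi E c N J v, localInt E c N J v]`** —
  `U(J)(𝔸_{F,f}) ≅ ∏'_v (U(J)(F_v) : U(J)(𝒪_v))` as topological groups, the restricted product over the finite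
  places `v` of `F` of the local groups `U(J)(F_v)` (`UnitaryGroup.localPi ≃ₜ* UnitaryGroup.«local»`) with respect to
  their compact open subgroups `U(J)(𝒪_v)` (`UnitaryGroup.localInt`). Construction: `GL_N(𝔸_E^∞) = ∏'_w GL_N(E_w)`
  (tree, Borel–Jacquet §4.1), regrouped over the places of `F` along `w ↦ w ∩ 𝓞 F` (tree `RestrictedProduct/Regroup`),
  in which `U(J)(𝔸_{F,f})` is the fibrewise cut-out by the local conditions (`mem_localPi_iff`), hence the restricted
  product of the fibres (tree `RestrictedProduct/Cutout`);
* the coordinate API: `finAdelicEquiv_apply_coe` (the `v`-component of `g` is `(g_w)_{w ∣ v}`), the projections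
  `evalPlace v : finAdelic →* localPi … v` (continuous) and `eventually_evalPlace_mem_localInt`
  (`g_v ∈ U(J)(𝒪_v)` for almost all `v`).

## Mathlib / tree

Mathlib: `RestrictedProduct`, `FiniteAdeleRing`, `Matrix.GeneralLinearGroup.map`; no Mathlib statement is
duplicated (Mathlib has no unitary groups over adele rings). Tree: `UnitaryGroupAutomorphicRep`
(`unitaryGroupOfForm`, `UnitaryGroup.adelic`, `finiteAdelic`, `adelicGroupData`), `UnitaryGroupLocalFactors`
(`localPi`, `localInt`, `mem_localPi_iff`, `placesOver`), `GLnFiniteAdeleRestrictedProduct` (`GLn.restrictedPiEquiv`,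
`GLn.evalAt`, `GLn.eventually_evalAt_mem_glInt`), `GLnAdelicStructure` (`GLn.ofFinite`), `GaloisActionAdeleRing`,
`RestrictedProduct/Regroup` (`regroupEquiv`), `RestrictedProduct/Cutout` (`cutout`, `cutoutEquiv`).

## Provenance

Written under the LEAN-IN-TREE rule (2026-08-18) for the pub-hodgecm formalisation cell (model-construction
sub-cell, seat mc-unitary-2). In the CM case (`F = L⁺ = maximalRealSubfield L`, `c` = complex conjugation)
`finAdelic` has the same carrier as that cell's package group `HodgeCM/PerL34/AdelicUnitaryFactorisation.Ufin L H`
(after its `HA_map_snd`), so this file is the place-by-place factorisation `U(H)(𝔸_{L⁺,f}) = ∏'_v U(H)(L⁺_v)` that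
local-global statements about theta lifts (local Weil representations, splittings, `⊗'_v`) are indexed by.
Nothing in this file is a claim of the manuscripts adjudicated by that cell.

## References

* V. Platonov, A. Rapinchuk, *Algebraic Groups and Number Theory*, Academic Press (1994), §5.1 (the adele group
  `G_𝔸 = ∏'_v (G_{F_v} : G_{𝒪_v})`) [PlatonovRapinchuk1994].
* J. W. S. Cassels, A. Fröhlich (eds.), *Algebraic Number Theory*, Academic Press (1967), Ch. II §§13–14
  (restricted topological products, adeles) [CasselsFrohlichANT1967].
* A. Borel, H. Jacquet, *Automorphic forms and automorphic representations*, Proc. Sympos. Pure Math. 33.1 (1979),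
  §4.1 (`G(𝔸_f) = ∏'_v G(F_v)` w.r.t. the `G(𝒪_v)`) [BorelJacquet1979].
-/

set_option autoImplicit false

noncomputable section

open NumberField IsDedekindDomain Topology Filter
open scoped Matrix MatrixGroups RestrictedProduct

namespace Literature.NumberTheory.Automorphic

open Literature.Topology.Algebra.RestrictedProduct (Fib fibSubgroup mem_fibSubgroup_iff regroupEquiv
  regroupEquiv_apply cutout mem_cutout_iff inH cutoutEquiv coe_cutoutEquiv_apply coe_cutoutEquiv_symm_apply)

/-! ## 1. `GL_N(𝔸_E^∞) ≃ₜ* ∏'_w [GL_N(E_w), GL_N(𝒪_w)]` as one `ContinuousMulEquiv` -/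

section GLPart

variable (n : ℕ) (K : Type) [Field K] [NumberField K]

/-- **`GL_n(𝔸_K^∞) ≃ₜ* ∏'_v [GL_n(K_v), GL_n(𝒪_v)]`** — the tree's group isomorphism `GLn.restrictedPiEquiv` together
with its bicontinuity (`GLn.restrictedPiHomeomorph`), as a single isomorphism of topological groups
(Borel–Jacquet 1979, §4.1). [cite: BorelJacquet1979, §4.1] -/
def GLn.restrictedPiContinuousMulEquiv : GL (Fin n) (FiniteAdeleRing (𝓞 K) K) ≃ₜ*
    Πʳ v : HeightOneSpectrum (𝓞 K), [GL (Fin n) (v.adicCompletion K), glInt n (v.adicCompletion K)] :=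
  { GLn.restrictedPiEquiv n K with
    continuous_toFun := GLn.continuous_toRestrictedPi
    continuous_invFun := GLn.continuous_restrictedPiEquiv_symm }

variable {n K} in
/-- Components of `GLn.restrictedPiContinuousMulEquiv y`: `GLn.evalAt v y`. [folklore] -/
@[simp] theorem GLn.restrictedPiContinuousMulEquiv_apply_apply (y : GL (Fin n) (FiniteAdeleRing (𝓞 K) K))
    (v : HeightOneSpectrum (𝓞 K)) : GLn.restrictedPiContinuousMulEquiv n K y v = GLn.evalAt n K v y := rfl

/-- A matrix identity over `𝔸_K^∞` holds iff it holds in every `M_n(K_v)`. [folklore] -/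
theorem Matrix.finiteAdele_eq_iff_forall {m : Type*} (M M' : Matrix m m (FiniteAdeleRing (𝓞 K) K)) :
    M = M' ↔ ∀ v : HeightOneSpectrum (𝓞 K),
      M.map (AdelicGroupData.finiteAdeleEval K v) = M'.map (AdelicGroupData.finiteAdeleEval K v) := by
  constructor
  · rintro rfl v
    rfl
  · intro h
    exact Matrix.ext fun a b => FiniteAdeleRing.ext K fun v => congrFun (congrFun (h v) a) b

end GLPart

/-! ## 2. Restriction of a `ContinuousMulEquiv` to matching subgroups -/

section Restrict

variable {A B : Type*} [Group A] [Group B] [TopologicalSpace A] [TopologicalSpace B]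

/-- An isomorphism of topological groups `e : A ≃ₜ* B` restricts to `S ≃ₜ* T` for subgroups with
`a ∈ S ↔ e a ∈ T`. [folklore] -/
def ContinuousMulEquiv.restrictSubgroup (e : A ≃ₜ* B) (S : Subgroup A) (T : Subgroup B)
    (h : ∀ a, a ∈ S ↔ e a ∈ T) : S ≃ₜ* T where
  toFun s := ⟨e s.1, (h s.1).1 s.2⟩
  invFun t := ⟨e.symm t.1, (h _).2 (by rw [ContinuousMulEquiv.apply_symm_apply]; exact t.2)⟩
  left_inv s := Subtype.ext (e.symm_apply_apply s.1)
  right_inv t := Subtype.ext (e.apply_symm_apply t.1)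
  map_mul' _ _ := Subtype.ext (map_mul e _ _)
  continuous_toFun := (e.continuous.comp continuous_subtype_val).subtype_mk _
  continuous_invFun := (e.symm.continuous.comp continuous_subtype_val).subtype_mk _

/-- `restrictSubgroup` on underlying elements. [folklore] -/
@[simp] theorem ContinuousMulEquiv.coe_restrictSubgroup_apply (e : A ≃ₜ* B) (S : Subgroup A) (T : Subgroup B)
    (h : ∀ a, a ∈ S ↔ e a ∈ T) (s : S) : ((ContinuousMulEquiv.restrictSubgroup e S T h s : T) : B) = e s := rfl

/-- `restrictSubgroup.symm` on underlying elements. [folklore] -/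
@[simp] theorem ContinuousMulEquiv.coe_restrictSubgroup_symm_apply (e : A ≃ₜ* B) (S : Subgroup A)
    (T : Subgroup B) (h : ∀ a, a ∈ S ↔ e a ∈ T) (t : T) :
    (((ContinuousMulEquiv.restrictSubgroup e S T h).symm t : S) : A) = e.symm t := rfl

end Restrict

namespace UnitaryGroup

variable (F E : Type) [Field F] [NumberField F] [Field E] [NumberField E] [Algebra F E]
variable (c : E ≃ₐ[F] E) (N : ℕ) (J : Matrix (Fin N) (Fin N) E)

/-! ## 3. `c ⊗ 1` on `𝔸_E^∞` and the finite-adelic points `U(J)(𝔸_{F,f}) ≤ GL_N(𝔸_E^∞)` -/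

/-- **`c ⊗ 1` on the finite adele ring `𝔸_E^∞ = E ⊗_F 𝔸_F^∞`**: the accepted action of `Aut(E/F)` on
`FiniteAdeleRing (𝓞 E) E` (`GaloisActionAdeleRing`, Cassels–Fröhlich VII §1.1), packaged by Mathlib's
`MulSemiringAction.toRingHom`; the finite component of `UnitaryGroup.conjAdele`. [cite: CasselsFrohlichANT1967, Ch. VII §1.1] -/
def conjFiniteAdele : FiniteAdeleRing (𝓞 E) E →+* FiniteAdeleRing (𝓞 E) E :=
  MulSemiringAction.toRingHom (E ≃ₐ[F] E) _ c

omit [NumberField F] in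
/-- `conjFiniteAdele c x = c • x` (definitional). [folklore] -/
@[simp] theorem conjFiniteAdele_apply (x : FiniteAdeleRing (𝓞 E) E) : conjFiniteAdele F E c x = c • x := rfl

omit [NumberField F] in
/-- Components: `((c ⊗ 1) x)_w = c_* (x_{c⁻¹ w})` (`FiniteAdeleRing.smul_apply`). [folklore] -/
theorem conjFiniteAdele_apply_apply (x : FiniteAdeleRing (𝓞 E) E) (w : HeightOneSpectrum (𝓞 E)) :
    conjFiniteAdele F E c x w = galAdicCompletionMap c (smul_inv_smul c w) (x (c⁻¹ • w)) := rfl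

omit [NumberField F] in
/-- `c ⊗ 1` is continuous on `𝔸_E^∞`. [folklore] -/
theorem continuous_conjFiniteAdele : Continuous (conjFiniteAdele F E c) :=
  FiniteAdeleRing.continuous_smul E c

omit [NumberField F] in
/-- The finite part of `conjAdele` is `conjFiniteAdele` (definitional). [folklore] -/
theorem conjAdele_snd (x : AdeleRing (𝓞 E) E) : (conjAdele F E c x).2 = conjFiniteAdele F E c x.2 := rfl

/-- `J` viewed over `𝔸_E^∞`. [folklore] -/
def finiteAdelicForm : Matrix (Fin N) (Fin N) (FiniteAdeleRing (𝓞 E) E) :=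
  J.map (algebraMap E (FiniteAdeleRing (𝓞 E) E))

/-- **The finite-adelic points `U(J)(𝔸_{F,f}) = {g ∈ GL_N(𝔸_E^∞) | ((c ⊗ 1) g)ᵀ · J · g = J}`**, a subgroup of
`GL_N(𝔸_E^∞) = (Res_{E/F} GL_N)(𝔸_F^∞)` (the tree's `unitaryGroupOfForm` over `𝔸_E^∞` with `c ⊗ 1`).
[cite: PlatonovRapinchuk1994, §5.1] -/
def finAdelic : Subgroup (GL (Fin N) (FiniteAdeleRing (𝓞 E) E)) :=
  unitaryGroupOfForm (conjFiniteAdele F E c) (finiteAdelicForm E N J)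

omit [NumberField F] in
/-- Membership in `U(J)(𝔸_{F,f})` (definitional). [folklore] -/
theorem mem_finAdelic_iff (g : GL (Fin N) (FiniteAdeleRing (𝓞 E) E)) :
    g ∈ finAdelic F E c N J ↔
      ((g : Matrix (Fin N) (Fin N) (FiniteAdeleRing (𝓞 E) E)).map (conjFiniteAdele F E c))ᵀ *
          finiteAdelicForm E N J * (g : Matrix (Fin N) (Fin N) (FiniteAdeleRing (𝓞 E) E)) =
        finiteAdelicForm E N J :=
  Iff.rfl

omit [NumberField F] in
/-- `U(J)(𝔸_{F,f})` is closed in `GL_N(𝔸_E^∞)`. [folklore] -/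
theorem isClosed_finAdelic :
    IsClosed (finAdelic F E c N J : Set (GL (Fin N) (FiniteAdeleRing (𝓞 E) E))) := by
  haveI : T2Space (FiniteAdeleRing (𝓞 E) E) := inferInstanceAs <| T2Space
    (RestrictedProduct (fun v : HeightOneSpectrum (𝓞 E) => v.adicCompletion E)
      (fun v => (v.adicCompletionIntegers E : Set (v.adicCompletion E))) Filter.cofinite)
  have h1 : Continuous fun g : GL (Fin N) (FiniteAdeleRing (𝓞 E) E) =>
      (g : Matrix (Fin N) (Fin N) (FiniteAdeleRing (𝓞 E) E)) := Units.continuous_val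
  have hc : Continuous fun g : GL (Fin N) (FiniteAdeleRing (𝓞 E) E) =>
      ((g : Matrix (Fin N) (Fin N) (FiniteAdeleRing (𝓞 E) E)).map (conjFiniteAdele F E c))ᵀ *
        finiteAdelicForm E N J * (g : Matrix (Fin N) (Fin N) (FiniteAdeleRing (𝓞 E) E)) :=
    ((h1.matrix_map (continuous_conjFiniteAdele F E c)).matrix_transpose.mul continuous_const).mul h1
  exact isClosed_eq hc continuous_const

omit [NumberField F] in
/-- The `w`-component of `J ⊗ 1 ∈ M_N(𝔸_E^∞)` is `J ∈ M_N(E_w)`. [folklore] -/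
theorem finiteAdelicForm_map_eval (w : HeightOneSpectrum (𝓞 E)) :
    (finiteAdelicForm E N J).map (AdelicGroupData.finiteAdeleEval E w) = placeForm J w := by
  rw [finiteAdelicForm, Matrix.map_map]
  rfl

omit [NumberField F] in
/-- The `w`-component of `(c ⊗ 1) g` is `c_* (g_{c⁻¹ w})`. [folklore] -/
theorem map_conjFiniteAdele_map_eval (g : GL (Fin N) (FiniteAdeleRing (𝓞 E) E)) (w : HeightOneSpectrum (𝓞 E)) :
    (((g : Matrix (Fin N) (Fin N) (FiniteAdeleRing (𝓞 E) E)).map (conjFiniteAdele F E c))).map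
        (AdelicGroupData.finiteAdeleEval E w) =
      ((GLn.evalAt N E (c⁻¹ • w) g : GL (Fin N) ((c⁻¹ • w).adicCompletion E)) :
          Matrix (Fin N) (Fin N) ((c⁻¹ • w).adicCompletion E)).map (galAdicCompletionMap c (smul_inv_smul c w)) :=
  Matrix.ext fun _ _ => rfl

omit [NumberField F] in
/-- The `w`-component of `g` is `GLn.evalAt w g`. [folklore] -/
theorem map_eval_eq_evalAt (g : GL (Fin N) (FiniteAdeleRing (𝓞 E) E)) (w : HeightOneSpectrum (𝓞 E)) :
    (g : Matrix (Fin N) (Fin N) (FiniteAdeleRing (𝓞 E) E)).map (AdelicGroupData.finiteAdeleEval E w) =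
      ((GLn.evalAt N E w g : GL (Fin N) (w.adicCompletion E)) : Matrix (Fin N) (Fin N) (w.adicCompletion E)) :=
  Matrix.ext fun _ _ => rfl

omit [NumberField F] in
/-- **Placewise membership criterion.** `g ∈ U(J)(𝔸_{F,f})` iff for every finite place `w` of `E`:
`(c_* g_{c⁻¹ w})ᵀ · J · g_w = J` in `M_N(E_w)`. [folklore] -/
theorem mem_finAdelic_iff_forall (g : GL (Fin N) (FiniteAdeleRing (𝓞 E) E)) :
    g ∈ finAdelic F E c N J ↔ ∀ w : HeightOneSpectrum (𝓞 E),
      (((GLn.evalAt N E (c⁻¹ • w) g : GL (Fin N) ((c⁻¹ • w).adicCompletion E)) :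
            Matrix (Fin N) (Fin N) ((c⁻¹ • w).adicCompletion E)).map
          (galAdicCompletionMap c (smul_inv_smul c w)))ᵀ * placeForm J w *
        ((GLn.evalAt N E w g : GL (Fin N) (w.adicCompletion E)) : Matrix (Fin N) (Fin N) (w.adicCompletion E)) =
        placeForm J w := by
  rw [mem_finAdelic_iff, Matrix.finiteAdele_eq_iff_forall]
  refine forall_congr' fun w => ?_
  rw [← RingHom.mapMatrix_apply, map_mul, map_mul, RingHom.mapMatrix_apply, RingHom.mapMatrix_apply,
    RingHom.mapMatrix_apply, Matrix.transpose_map, map_conjFiniteAdele_map_eval, map_eval_eq_evalAt,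
    finiteAdelicForm_map_eval]

/-! ## 4. Agreement with `UnitaryGroup.finiteAdelic` (`(1, g) ∈ U(J)(𝔸_F) ↔ g ∈ U(J)(𝔸_{F,f})`) -/

omit [NumberField F] in
/-- The archimedean part of `GLn.ofFinite g` is `1`. [folklore] -/
theorem map_fst_ofFinite (g : GL (Fin N) (FiniteAdeleRing (𝓞 E) E)) :
    (GLn.ofFinite N E g).val.map (adeleFst E) = 1 := by
  ext i j
  simp only [Matrix.map_apply]
  rw [GLn.coe_ofFinite_apply]
  rfl

omit [NumberField F] in
/-- The finite part of `GLn.ofFinite g` is `g`. [folklore] -/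
theorem map_snd_ofFinite (g : GL (Fin N) (FiniteAdeleRing (𝓞 E) E)) :
    (GLn.ofFinite N E g).val.map (adeleSnd E) = g.val := by
  ext i j
  simp only [Matrix.map_apply]
  rw [GLn.coe_ofFinite_apply]
  rfl

omit [NumberField F] in
/-- **`(1, g) ∈ U(J)(𝔸_F) ↔ g ∈ U(J)(𝔸_{F,f})`**: the unitary condition on `GL_N(𝔸_E) = GL_N(E_∞) × GL_N(𝔸_E^∞)`
splits into its archimedean part (trivial on `1`) and its finite part. [folklore] -/
theorem ofFinite_mem_adelic_iff (g : GL (Fin N) (FiniteAdeleRing (𝓞 E) E)) :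
    GLn.ofFinite N E g ∈ adelic F E c N J ↔ g ∈ finAdelic F E c N J := by
  rw [adelic, mem_unitaryGroupOfForm_iff, mem_finAdelic_iff]
  set G : Matrix (Fin N) (Fin N) (AdeleRing (𝓞 E) E) := (GLn.ofFinite N E g).val
  have hfst : G.map (adeleFst E) = 1 := map_fst_ofFinite E N g
  have hsnd : G.map (adeleSnd E) = g.val := map_snd_ofFinite E N g
  have hσfst : (G.map (conjAdele F E c)).map (adeleFst E) = 1 := by
    rw [Matrix.map_map,
      show (adeleFst E ∘ conjAdele F E c : AdeleRing (𝓞 E) E → InfiniteAdeleRing E) =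
        (MulSemiringAction.toRingHom (E ≃ₐ[F] E) (InfiniteAdeleRing E) c) ∘ adeleFst E from rfl,
      ← Matrix.map_map, hfst, Matrix.map_one _ (map_zero _) (map_one _)]
  have hσsnd : (G.map (conjAdele F E c)).map (adeleSnd E) = g.val.map (conjFiniteAdele F E c) := by
    rw [Matrix.map_map,
      show (adeleSnd E ∘ conjAdele F E c : AdeleRing (𝓞 E) E → FiniteAdeleRing (𝓞 E) E) =
        (conjFiniteAdele F E c) ∘ adeleSnd E from rfl,
      ← Matrix.map_map, hsnd]
  have hJfst : (adelicForm E N J).map (adeleFst E) = J.map (algebraMap E (InfiniteAdeleRing E)) := by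
    rw [adelicForm, Matrix.map_map]; rfl
  have hJsnd : (adelicForm E N J).map (adeleSnd E) = finiteAdelicForm E N J := by
    rw [adelicForm, finiteAdelicForm, Matrix.map_map]; rfl
  constructor
  · intro h
    have key := congrArg (fun M : Matrix (Fin N) (Fin N) (AdeleRing (𝓞 E) E) => M.map (adeleSnd E)) h
    simp only [Matrix.map_mul, Matrix.transpose_map] at key
    rw [hσsnd, hsnd, hJsnd] at key
    exact key
  · intro h
    refine matrix_adele_ext E N ?_ ?_
    · rw [Matrix.map_mul, Matrix.map_mul, Matrix.transpose_map, hσfst, hfst, Matrix.transpose_one,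
        Matrix.one_mul, Matrix.mul_one]
    · rw [Matrix.map_mul, Matrix.map_mul, Matrix.transpose_map, hσsnd, hsnd, hJsnd]
      exact h

/-- **`U(J)(𝔸_{F,f}) →* U(J)(𝔸_F)`, `g ↦ (1, g)`** (restriction of the tree's `GLn.ofFinite`), typed on the adelic
points of the datum `adelicGroupData F E c N J`. [folklore] -/
def finAdelicToAdelic : finAdelic F E c N J →* (adelicGroupData F E c N J).Adelic :=
  ((GLn.ofFinite N E).comp (finAdelic F E c N J).subtype).codRestrict (adelic F E c N J)
    fun g => (ofFinite_mem_adelic_iff F E c N J g.1).2 g.2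

/-- Underlying matrices: `adelicVal (finAdelicToAdelic g) = GLn.ofFinite g`. [folklore] -/
@[simp] theorem adelicVal_finAdelicToAdelic (g : finAdelic F E c N J) :
    adelicVal F E c N J (finAdelicToAdelic F E c N J g) = GLn.ofFinite N E g := rfl

omit [NumberField F] in
/-- `GLn.ofFinite` is injective (its finite part is the identity). [folklore] -/
theorem ofFinite_injective' : Function.Injective (GLn.ofFinite N E) := fun a b h => by
  have := congrArg (fun G : GL (Fin N) (AdeleRing (𝓞 E) E) => G.val.map (adeleSnd E)) h
  simp only [map_snd_ofFinite] at this
  exact Units.ext this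

/-- `finAdelicToAdelic` is injective. [folklore] -/
theorem finAdelicToAdelic_injective : Function.Injective (finAdelicToAdelic F E c N J) := by
  intro a b h
  have h' := congrArg (adelicVal F E c N J) h
  simp only [adelicVal_finAdelicToAdelic] at h'
  exact Subtype.ext (ofFinite_injective' E N h')

/-- **The two descriptions of the finite-adelic points agree**: the range of `g ↦ (1, g)` on `U(J)(𝔸_{F,f})` is the
tree's `UnitaryGroup.finiteAdelic` (`= U(J)(𝔸_F) ∩ ({1} × GL_N(𝔸_E^∞))`). [folklore] -/
theorem range_finAdelicToAdelic : (finAdelicToAdelic F E c N J).range = finiteAdelic F E c N J := by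
  ext x
  constructor
  · rintro ⟨g, rfl⟩
    exact ⟨g.1, rfl⟩
  · rintro ⟨g₀, hg₀⟩
    -- `hg₀ : GLn.ofFinite N E g₀ = adelicVal x`
    have hmem : g₀ ∈ finAdelic F E c N J := by
      rw [← ofFinite_mem_adelic_iff]
      rw [show GLn.ofFinite N E g₀ = adelicVal F E c N J x from hg₀]
      exact (x : adelic F E c N J).2
    exact ⟨⟨g₀, hmem⟩, adelicVal_injective F E c N J hg₀⟩

/-- `finAdelicToAdelic` is continuous. [folklore] -/
theorem continuous_finAdelicToAdelic : Continuous (finAdelicToAdelic F E c N J) :=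
  Continuous.subtype_mk ((GLn.continuous_ofFinite N E).comp continuous_subtype_val) _

/-! ## 5. The main theorem: `U(J)(𝔸_{F,f}) ≃ₜ* ∏'_v (U(J)(F_v) : U(J)(𝒪_v))` -/

/-- The integral structure `(GL_N(𝒪_w))_w` of `∏'_w GL_N(E_w)`, as a family (abbreviation). [folklore] -/
abbrev glIntFamily (w : HeightOneSpectrum (𝓞 E)) : Subgroup (GL (Fin N) (w.adicCompletion E)) :=
  glInt N (w.adicCompletion E)

/-- Step 1–2: `GL_N(𝔸_E^∞) ≃ₜ* ∏'_w GL_N(E_w) ≃ₜ* ∏'_v Π_{w∣v} GL_N(E_w)` (tree `GLn.restrictedPiEquiv`, then the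
regrouping `RestrictedProduct/Regroup.regroupEquiv` along `w ↦ w ∩ 𝓞 F`). [folklore] -/
def glRegroup : GL (Fin N) (FiniteAdeleRing (𝓞 E) E) ≃ₜ*
    Πʳ v : HeightOneSpectrum (𝓞 F), [LocalGLPi E N v, localIntBox E N v] :=
  (GLn.restrictedPiContinuousMulEquiv N E).trans
    (regroupEquiv (glIntFamily E N) (tendsto_placesOver_cofinite F E))

/-- Coordinates of `glRegroup g`: `(glRegroup g) v w = g_w = GLn.evalAt w g`. [folklore] -/
@[simp] theorem glRegroup_apply_apply (g : GL (Fin N) (FiniteAdeleRing (𝓞 E) E)) (v : HeightOneSpectrum (𝓞 F))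
    (w : PlacesOver E v) : glRegroup F E N g v w = GLn.evalAt N E w.1 g := rfl

/-- Step 3: under `glRegroup`, `U(J)(𝔸_{F,f})` is the fibrewise cut-out by the local groups `U(J)(F_v)`. [folklore] -/
theorem mem_finAdelic_iff_glRegroup_mem_cutout (g : GL (Fin N) (FiniteAdeleRing (𝓞 E) E)) :
    g ∈ finAdelic F E c N J ↔
      glRegroup F E N g ∈ cutout (fun v => localIntBox E N v) (fun v => localPi E c N J v) := by
  rw [mem_cutout_iff, mem_finAdelic_iff_forall]
  simp only [mem_localPi_iff, glRegroup_apply_apply]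
  constructor
  · intro h v w
    exact h w.1
  · intro h w
    exact h (w.under (𝓞 F)) ⟨w, rfl⟩

/-- **Main theorem. `U(J)(𝔸_{F,f}) ≃ₜ* ∏'_v (U(J)(F_v) : U(J)(𝒪_v))`** as topological groups — the finite-adelic
unitary group is the restricted product over the finite places `v` of `F` of the local unitary groups
`U(J)(F_v)` (`localPi … v ≃ₜ* «local» … v`) with respect to the compact open subgroups `U(J)(𝒪_v)` (`localInt`)
(Platonov–Rapinchuk 1994, §5.1; Borel–Jacquet 1979, §4.1). [cite: PlatonovRapinchuk1994, §5.1] -/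
def finAdelicEquiv : finAdelic F E c N J ≃ₜ*
    Πʳ v : HeightOneSpectrum (𝓞 F), [localPi E c N J v, localInt E c N J v] :=
  (ContinuousMulEquiv.restrictSubgroup (glRegroup F E N) (finAdelic F E c N J)
      (cutout (fun v => localIntBox E N v) (fun v => localPi E c N J v))
      (mem_finAdelic_iff_glRegroup_mem_cutout F E c N J)).trans
    (cutoutEquiv (fun v => localIntBox E N v) (fun v => localPi E c N J v)).symm

/-- **Coordinates of `finAdelicEquiv`**: the `v`-component of `g ∈ U(J)(𝔸_{F,f})` is `(g_w)_{w ∣ v}`. [folklore] -/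
@[simp] theorem finAdelicEquiv_apply_coe (g : finAdelic F E c N J) (v : HeightOneSpectrum (𝓞 F)) (w : PlacesOver E v) :
    ((finAdelicEquiv F E c N J g v : localPi E c N J v) : LocalGLPi E N v) w = GLn.evalAt N E w.1 g.1 := rfl

/-- **The projection `U(J)(𝔸_{F,f}) →* U(J)(F_v)`**, `g ↦ (g_w)_{w ∣ v}` (the `v`-component of `finAdelicEquiv`).
[folklore] -/
def evalPlace (v : HeightOneSpectrum (𝓞 F)) : finAdelic F E c N J →* localPi E c N J v :=
  (RestrictedProduct.evalMonoidHom (fun v : HeightOneSpectrum (𝓞 F) => localPi E c N J v) v).comp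
    (finAdelicEquiv F E c N J).toMonoidHom

/-- Coordinates of `evalPlace`. [folklore] -/
@[simp] theorem coe_evalPlace_apply (v : HeightOneSpectrum (𝓞 F)) (g : finAdelic F E c N J) (w : PlacesOver E v) :
    ((evalPlace F E c N J v g : localPi E c N J v) : LocalGLPi E N v) w = GLn.evalAt N E w.1 g.1 := rfl

/-- `evalPlace v` is continuous. [folklore] -/
theorem continuous_evalPlace (v : HeightOneSpectrum (𝓞 F)) : Continuous (evalPlace F E c N J v) :=
  (RestrictedProduct.continuous_eval v).comp (finAdelicEquiv F E c N J).continuous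

/-- `evalPlace v` agrees with the tree's `UnitaryGroup.toLocal v` on `(1, g)`, up to `GL_N(Π_w E_w) = Π_w GL_N(E_w)`:
`localPiEquiv (evalPlace v g) = toLocal v (1, g)`. [folklore] -/
theorem localPiEquiv_evalPlace (v : HeightOneSpectrum (𝓞 F)) (g : finAdelic F E c N J) :
    ((localPiEquiv E c N J v (evalPlace F E c N J v g) : «local» E c N J v) : GL (Fin N) (LocalRing E v)) =
      ((toLocal E c N J v (finAdelicToAdelic F E c N J g : adelic F E c N J) : «local» E c N J v) :
        GL (Fin N) (LocalRing E v)) := by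
  refine Units.ext (Matrix.ext fun a b => funext fun w => ?_)
  change ((GLn.evalAt N E w.1 g.1 : GL (Fin N) (w.1.adicCompletion E)) :
      Matrix (Fin N) (Fin N) (w.1.adicCompletion E)) a b =
    adeleToLocal E v (((GLn.ofFinite N E g.1 : GL (Fin N) (AdeleRing (𝓞 E) E)) :
      Matrix (Fin N) (Fin N) (AdeleRing (𝓞 E) E)) a b) w
  rw [adeleToLocal_apply, GLn.coe_ofFinite_apply]
  rfl

/-- **Almost all components are integral**: `g_v ∈ U(J)(𝒪_v)` for all but finitely many `v`. [folklore] -/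
theorem eventually_evalPlace_mem_localInt (g : finAdelic F E c N J) :
    ∀ᶠ v in cofinite, evalPlace F E c N J v g ∈ localInt E c N J v :=
  (finAdelicEquiv F E c N J g).2

/-- `U(J)(𝒪_v)`-membership of the `v`-component, entrywise: all `g_w ∈ GL_N(𝒪_w)`, `w ∣ v`. [folklore] -/
theorem evalPlace_mem_localInt_iff (v : HeightOneSpectrum (𝓞 F)) (g : finAdelic F E c N J) :
    evalPlace F E c N J v g ∈ localInt E c N J v ↔
      ∀ w : PlacesOver E v, GLn.evalAt N E w.1 g.1 ∈ glInt N (w.1.adicCompletion E) :=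
  (mem_localInt_iff E c N J v _).trans (forall_congr' fun w => by rw [coe_evalPlace_apply])

/-! ## 6. The integral level `K_f⁰ = U(J)(𝔸_{F,f}) ∩ GL_N(𝒪̂_E) = ∏_v U(J)(𝒪_v)` (compact open, factorizable) -/

/-- **The integral level `K_f⁰ = U(J)(𝔸_{F,f}) ∩ GL_N(𝒪̂_E)`** of the finite-adelic unitary group (trace of the
tree's `glFiniteIntegralLevel`). [cite: BorelJacquet1979, §4.1] -/
def finAdelicIntegralLevel : Subgroup (finAdelic F E c N J) :=
  (glFiniteIntegralLevel N E).subgroupOf (finAdelic F E c N J)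

omit [NumberField F] in
/-- Membership in the integral level (definitional). [folklore] -/
theorem mem_finAdelicIntegralLevel_iff (g : finAdelic F E c N J) :
    g ∈ finAdelicIntegralLevel F E c N J ↔ (g : GL (Fin N) (FiniteAdeleRing (𝓞 E) E)) ∈ glFiniteIntegralLevel N E :=
  Iff.rfl

/-- **`K_f⁰` is factorizable: `K_f⁰ = ∏_v U(J)(𝒪_v)`** — under `finAdelicEquiv`, `g ∈ K_f⁰` iff every
`v`-component lies in `U(J)(𝒪_v)` (`GLn.mem_glFiniteIntegralLevel_iff_forall_evalAt`, regrouped over the places of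
`F`). [cite: PlatonovRapinchuk1994, §5.1] -/
theorem mem_finAdelicIntegralLevel_iff_forall (g : finAdelic F E c N J) :
    g ∈ finAdelicIntegralLevel F E c N J ↔
      ∀ v : HeightOneSpectrum (𝓞 F), finAdelicEquiv F E c N J g v ∈ localInt E c N J v := by
  rw [mem_finAdelicIntegralLevel_iff, GLn.mem_glFiniteIntegralLevel_iff_forall_evalAt]
  simp only [mem_localInt_iff, finAdelicEquiv_apply_coe]
  constructor
  · intro h v w
    exact h w.1
  · intro h w
    exact h (w.under (𝓞 F)) ⟨w, rfl⟩

omit [NumberField F] in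
/-- `K_f⁰` is open in `U(J)(𝔸_{F,f})`. [folklore] -/
theorem isOpen_finAdelicIntegralLevel :
    IsOpen (finAdelicIntegralLevel F E c N J : Set (finAdelic F E c N J)) :=
  (isOpen_glFiniteIntegralLevel N E).preimage continuous_subtype_val

omit [NumberField F] in
/-- **`K_f⁰` is compact** (closed subgroup `U(J)(𝔸_{F,f})` meets the compact `GL_N(𝒪̂_E)`, tree
`isCompact_glFiniteIntegralLevel_holds`). [cite: PlatonovRapinchuk1994, §5.1] -/
theorem isCompact_finAdelicIntegralLevel :
    IsCompact (finAdelicIntegralLevel F E c N J : Set (finAdelic F E c N J)) :=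
  (isClosed_finAdelic F E c N J).isClosedEmbedding_subtypeVal.isCompact_preimage
    (isCompact_glFiniteIntegralLevel_holds N E)

/-- `K_f⁰` maps into the tree's integral level of `U(J)(𝔸_F)` under `g ↦ (1, g)` (so it is one of the
admissible `finiteLevels`, cf. `integralLevel_mem_finiteLevels`). [folklore] -/
theorem finAdelicToAdelic_mem_integralLevel (g : finAdelic F E c N J) (hg : g ∈ finAdelicIntegralLevel F E c N J) :
    finAdelicToAdelic F E c N J g ∈
      ((glFiniteIntegralLevel N E).map (GLn.ofFinite N E)).comap (adelic F E c N J).subtype :=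
  ⟨g.1, hg, rfl⟩

end UnitaryGroup

end Literature.NumberTheory.Automorphic

end
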